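import Mathlib
import Summits.CriticalPhenomena.PercolationContinuityZ3.Theorems.PercNearOneGluingNoHeavyLowerTailHexMSMatchReservedTerms
import Summits.CriticalPhenomena.PercolationContinuityZ3.Theorems.PercNearOneGluingNoHeavyLowerTailHexMSMatchPureSCOne

/-!
# (Π2″) from reserved terms ANYWHERE in the closed term family: the extended menu (hp-7 gen 80)

Support file for crux `stmt-CriticalPhenomena-4575` (route `PercNearOneGluingNoHeavy`), hull-port seat `prim-hp-7` (generation 80);
`--supports stmt-CriticalPhenomena-4575`.  No `sorry`.  Memo: `run/shared/lean/prim/prim-hp-7/FROM-prim-hp-7-g80-TWO-DIRECTIONS.md`.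

The second-difference reduction (`GeneratedDonors.two_mul_card_le_card_clU_scTerms_of_ms2`, gen 72) proves the pure SC inequality
(Π2″) `2 (#P + #Q + #W) ≤ #clU U (scTerms P Q W)` for dead-like blocks from the (MS2) count, which uses only THREE of the term families of
`scTerms` (the differences of members and the second differences `p \ d₅`, `q \ d₂`).  The order certificates of gens 76–78 reserve,
for every designated cross difference `d`, a term of that small family avoiding the forward differences of a rank on `F = P ∪ Q`.

This file removes the restriction: the reserved family `Θ` may consist of ANY members of the complement-closed term family
`clU U (scTerms P Q W)` — in the language of the designated sets `d₅ = w`, `d₂ = U \ w` these are, besides `f \ g`, `p \ d₅` and `q \ d₂`,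
the six further families `q ∩ d₅`, `d₅ \ p`, `U \ (q ∪ d₅)` (the second differences of the complement-mirror instance `(U \ Q, U \ P)`),
`p ∩ d₂`, `d₂ \ q`, `U \ (p ∪ d₂)`, and all their complements.  Numerically (memo §3) order certificates with this EXTENDED MENU along the
canonical size order exist for every instance of the gen-78 residue (1 452 + 3 240 instances on `2^[6]`) where the natural menu has none.

* `ExtReserved.scTerms_subset_ground` — every term lies inside `U`.
* `ExtReserved.two_mul_card_le_card_clU_scTerms_of_reserved` — **(Π2″) from reserved closed terms**: for dead-like blocks `P`, `Q`
  (pairwise intersecting, non-covering subsets of `U`, disjoint) and blockers `W ⊆ U`, a rank `r` on `F` and a family `Θ ⊆ clU U (scTerms P Q W)`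
  with `#W ≤ #Θ`, `∅ ∉ Θ`, no member of `Θ` the complement of a difference of members or of a member of `Θ`, and every forward difference
  `f \ g` (`f ≠ g`, `r f ≤ r g`) nonempty and outside `Θ`: then `2 (#P + #Q + #W) ≤ #clU U (scTerms P Q W)`.
  (Ordered Marica–Schönheim with reserved terms on `T = F \\ F ∪ Θ`, then `#clU U T = 2 #T` by dead-likeness.)
* `ExtReserved.mem_clU_scTerms_of_mem` — the extended menu: for `w ∈ W`, `p ∈ P`, `q ∈ Q` the eight sets `p \ w`, `w \ p`, `q ∩ w`, `q ∪ w`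
  and their complements in `U` lie in `clU U (scTerms P Q W)`.
* `ExtReserved.card_le_card_designated` — `#W ≤ #(D₅ ∪ D₂)` for complement-free representatives `W ⊆ scReps U P Q`
  (`D₅ = W ∩ (P \\ Q)`, `D₂ = {d ∈ Q \\ P | U \ d ∈ W}`), extracted from the gen-72 reduction, so that `Θ = τ '' (D₅ ∪ D₂)` for an
  injective `τ` meets the cardinality hypothesis.
-/

namespace Summit.CriticalPhenomena.PercolationContinuityZ3.Theorems

namespace ExtReserved

open Finset GeneratedDonors
open scoped FinsetFamily

variable {α : Type*} [DecidableEq α] {U : Finset α}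

/-- Every term of `scTerms P Q W` lies inside `U` when the members and blockers do. -/
theorem scTerms_subset_ground {P Q W : Finset (Finset α)} (hU : ∀ a ∈ P ∪ Q, a ⊆ U) (hWU : ∀ w ∈ W, w ⊆ U) :
    ∀ t ∈ scTerms P Q W, t ⊆ U := by
  intro t ht
  unfold scTerms at ht
  simp only [mem_union] at ht
  have hP : ∀ a ∈ P, a ⊆ U := fun a ha => hU a (mem_union_left _ ha)
  have hQ : ∀ a ∈ Q, a ⊆ U := fun a ha => hU a (mem_union_right _ ha)
  rcases ht with ((((((h | h) | h) | h) | h) | h) | h) | h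
  · obtain ⟨a, ha, b, -, rfl⟩ := mem_diffs.mp h; exact sdiff_subset.trans (hP a ha)
  · obtain ⟨a, ha, b, -, rfl⟩ := mem_diffs.mp h; exact sdiff_subset.trans (hQ a ha)
  · obtain ⟨a, ha, b, -, rfl⟩ := mem_diffs.mp h; exact sdiff_subset.trans (hP a ha)
  · obtain ⟨a, ha, b, -, rfl⟩ := mem_diffs.mp h; exact sdiff_subset.trans (hQ a ha)
  · obtain ⟨a, ha, b, -, rfl⟩ := mem_diffs.mp h; exact sdiff_subset.trans (hP a ha)
  · obtain ⟨a, ha, b, -, rfl⟩ := mem_diffs.mp h; exact sdiff_subset.trans (hWU a ha)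
  · obtain ⟨a, ha, b, -, rfl⟩ := mem_infs.mp h; exact inter_subset_left.trans (hQ a ha)
  · obtain ⟨a, ha, b, hb, rfl⟩ := mem_sups.mp h; exact union_subset (hQ a ha) (hWU b hb)

/-- **(Π2″) from reserved closed terms** (hp-7 gen 80).  Dead-like blocks `P`, `Q` in `U` with blockers `W ⊆ U`; a rank `r` on
`F = P ∪ Q`; a reserved family `Θ` of NONEMPTY members of `clU U (scTerms P Q W)`, at least `#W` of them, none the complement of a
difference of two members or of another reserved term; every forward difference `f \ g` (`f ≠ g`, `r f ≤ r g`) nonempty and unreserved.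
Then `2 (#P + #Q + #W) ≤ #clU U (scTerms P Q W)`. -/
theorem two_mul_card_le_card_clU_scTerms_of_reserved {β : Type*} [LinearOrder β] (P Q W Θ : Finset (Finset α))
    (r : Finset α → β)
    (hU : ∀ a ∈ P ∪ Q, a ⊆ U) (hWU : ∀ w ∈ W, w ⊆ U) (hPQ : Disjoint P Q)
    (hcov : ∀ a ∈ P ∪ Q, ∀ b ∈ P ∪ Q, a ∪ b ≠ U)
    (hΘ : ∀ θ ∈ Θ, θ ∈ clU U (scTerms P Q W)) (hWΘ : #W ≤ #Θ) (h0Θ : (∅ : Finset α) ∉ Θ)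
    (hΘco : ∀ a ∈ Θ, ∀ b ∈ ((P ∪ Q) \\ (P ∪ Q)) ∪ Θ, a ≠ U \ b)
    (hfwd : ∀ f ∈ P ∪ Q, ∀ g ∈ P ∪ Q, f ≠ g → r f ≤ r g → f \ g ≠ ∅ ∧ f \ g ∉ Θ) :
    2 * (#P + #Q + #W) ≤ #(clU U (scTerms P Q W)) := by
  classical
  set F := P ∪ Q with hFdef
  have hcardF : #F = #P + #Q := card_union_of_disjoint hPQ
  have hTU : ∀ t ∈ scTerms P Q W, t ⊆ U := scTerms_subset_ground hU hWU
  have hcc : ∀ {a : Finset α}, a ⊆ U → U \ (U \ a) = a := fun ha => Finset.sdiff_sdiff_eq_self ha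
  -- reserved terms lie inside `U`
  have hΘU : ∀ θ ∈ Θ, θ ⊆ U := by
    intro θ hθ
    rcases mem_clU.mp (hΘ θ hθ) with h | ⟨t, -, rfl⟩
    · exact hTU θ h
    · exact sdiff_subset
  rcases F.eq_empty_or_nonempty with hF0 | ⟨f₀, hf₀⟩
  · -- no members: no terms at all, so `Θ = ∅` and `W = ∅`
    have hP : P = ∅ := subset_empty.mp (hF0 ▸ (subset_union_left : P ⊆ F))
    have hQ : Q = ∅ := subset_empty.mp (hF0 ▸ (subset_union_right : Q ⊆ F))
    have hT0 : scTerms P Q W = ∅ := by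
      rw [hP, hQ]; unfold scTerms
      simp [Finset.empty_sdiffs, Finset.diffs_empty, Finset.empty_infs, Finset.empty_sups]
    have hΘ0 : Θ = ∅ := by
      rw [eq_empty_iff_forall_notMem]
      intro θ hθ
      have := hΘ θ hθ
      rw [hT0] at this
      unfold clU at this
      simp at this
    rw [hΘ0, card_empty] at hWΘ
    have hW0 : #W = 0 := Nat.le_zero.mp hWΘ
    rw [hP, hQ, card_empty, hW0]
    simp
  -- the term set of the certificate
  set T : Finset (Finset α) := (F \\ F) ∪ Θ with hTdef
  have h0T : (∅ : Finset α) ∈ T :=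
    mem_union_left _ (mem_diffs.mpr ⟨f₀, hf₀, f₀, hf₀, (by simp : f₀ \ f₀ = ∅)⟩)
  have hΘT : Θ ⊆ T := subset_union_right
  have hres : #F + #Θ ≤ #T := by
    refine ReservedTerms.card_add_card_le_card_of_reserved F T Θ r h0T hΘT h0Θ ?_
    intro f hf g hg hne hr
    obtain ⟨hne0, hnot⟩ := hfwd f hf g hg hne hr
    exact ⟨mem_union_left _ (mem_diffs.mpr ⟨f, hf, g, hg, rfl⟩), hne0, hnot⟩
  -- every term of `T` lies inside `U`
  have hTsub : ∀ t ∈ T, t ⊆ U := by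
    intro t ht
    rcases mem_union.mp ht with ht | ht
    · obtain ⟨a, ha, b, -, rfl⟩ := mem_diffs.mp ht; exact sdiff_subset.trans (hU a ha)
    · exact hΘU t ht
  -- no two terms of `T` are complementary
  have hnoco : ∀ a ∈ T, ∀ b ∈ T, a ≠ U \ b := by
    intro a ha b hb hab
    rcases mem_union.mp ha with ha' | ha'
    · rcases mem_union.mp hb with hb' | hb'
      · obtain ⟨f, hf, g, -, rfl⟩ := mem_diffs.mp ha'
        obtain ⟨f', hf', g', -, rfl⟩ := mem_diffs.mp hb'
        apply hcov f hf f' hf'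
        apply Subset.antisymm (union_subset (hU f hf) (hU f' hf'))
        intro i hiU
        rw [mem_union]
        by_cases hif' : i ∈ f' \ g'
        · exact Or.inr (mem_sdiff.mp hif').1
        · have : i ∈ U \ (f' \ g') := mem_sdiff.mpr ⟨hiU, hif'⟩
          rw [← hab] at this
          exact Or.inl (mem_sdiff.mp this).1
      · -- `a ∈ F \\ F`, `b ∈ Θ`: then `b = U \ a`
        have hba : b = U \ a := by rw [hab, hcc (hΘU b hb')]
        exact hΘco b hb' a (mem_union_left _ ha') hba
    · exact hΘco a ha' b hb hab
  -- hence `#clU U T = 2 #T`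
  have hclT : #(clU U T) = 2 * #T := by
    unfold clU
    have hinj : Set.InjOn (fun s : Finset α => U \ s) ↑T := by
      intro s hs t ht hst
      have h1 := congrArg (fun x => U \ x) hst
      simp only [hcc (hTsub s (mem_coe.mp hs)), hcc (hTsub t (mem_coe.mp ht))] at h1
      exact h1
    have hdisj : Disjoint T (T.image fun s => U \ s) := by
      rw [Finset.disjoint_left]
      intro t ht htc
      obtain ⟨s, hs, hst⟩ := mem_image.mp htc
      exact hnoco t ht s hs hst.symm
    rw [card_union_of_disjoint hdisj, card_image_of_injOn hinj]; ring
  -- and `clU U T ⊆ clU U (scTerms P Q W)`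
  have hTcl : ∀ t ∈ T, t ∈ clU U (scTerms P Q W) := by
    intro t ht
    rcases mem_union.mp ht with ht | ht
    · obtain ⟨a, ha, b, hb, rfl⟩ := mem_diffs.mp ht
      refine mem_clU.mpr (Or.inl ?_)
      unfold scTerms; simp only [mem_union]
      rcases mem_union.mp ha with ha | ha <;> rcases mem_union.mp hb with hb | hb
      · exact Or.inl (Or.inl (Or.inl (Or.inl (Or.inl (Or.inl (Or.inl (mem_diffs.mpr ⟨a, ha, b, hb, rfl⟩)))))))
      · exact Or.inl (Or.inl (Or.inl (Or.inl (Or.inl (Or.inr (mem_diffs.mpr ⟨a, ha, b, hb, rfl⟩))))))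
      · exact Or.inl (Or.inl (Or.inl (Or.inl (Or.inr (mem_diffs.mpr ⟨a, ha, b, hb, rfl⟩)))))
      · exact Or.inl (Or.inl (Or.inl (Or.inl (Or.inl (Or.inl (Or.inr (mem_diffs.mpr ⟨a, ha, b, hb, rfl⟩)))))))
    · exact hΘ t ht
  have hsub : clU U T ⊆ clU U (scTerms P Q W) := by
    intro x hx
    rcases mem_clU.mp hx with hx | ⟨t, ht, rfl⟩
    · exact hTcl x hx
    · exact compl_mem_clU hTU (hTsub t ht) (hTcl t ht)
  have := card_le_card hsub
  rw [hclT] at this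
  omega

/-- **The extended menu** (hp-7 gen 80): for a blocker `w ∈ W` and members `p ∈ P`, `q ∈ Q`, the sets `p \ w`, `w \ p`, `q ∩ w`,
`q ∪ w` and their complements in `U` all belong to `clU U (scTerms P Q W)`.  (For a type-5 representative `w = d₅` these are the
second differences `p \ d₅`, the sets `d₅ \ p`, `q ∩ d₅`, `q ∪ d₅` and, among the complements, `U \ (q ∪ d₅) = (U \ q) \ d₅` — the
second differences of the complement-mirror instance; for a type-2 representative `w = p₀ ∪ (U \ q₀)`, `d₂ = q₀ \ p₀ = U \ w`, they
are `p ∩ d₂ = p \ w`, `U \ (p ∪ d₂) = w \ p`, `q \ d₂ = q ∩ w`, `U \ (d₂ \ q) = q ∪ w` and complements.) -/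
theorem mem_clU_scTerms_of_mem {P Q W : Finset (Finset α)} (hU : ∀ a ∈ P ∪ Q, a ⊆ U) (hWU : ∀ w ∈ W, w ⊆ U)
    {w p q : Finset α} (hw : w ∈ W) (hp : p ∈ P) (hq : q ∈ Q) :
    p \ w ∈ clU U (scTerms P Q W) ∧ w \ p ∈ clU U (scTerms P Q W) ∧
    q ∩ w ∈ clU U (scTerms P Q W) ∧ q ∪ w ∈ clU U (scTerms P Q W) ∧
    U \ (p \ w) ∈ clU U (scTerms P Q W) ∧ U \ (w \ p) ∈ clU U (scTerms P Q W) ∧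
    U \ (q ∩ w) ∈ clU U (scTerms P Q W) ∧ U \ (q ∪ w) ∈ clU U (scTerms P Q W) := by
  have hTU : ∀ t ∈ scTerms P Q W, t ⊆ U := scTerms_subset_ground hU hWU
  have h1 : p \ w ∈ scTerms P Q W := by
    unfold scTerms; simp only [mem_union]
    exact Or.inl (Or.inl (Or.inl (Or.inr (mem_diffs.mpr ⟨p, hp, w, hw, rfl⟩))))
  have h2 : w \ p ∈ scTerms P Q W := by
    unfold scTerms; simp only [mem_union]
    exact Or.inl (Or.inl (Or.inr (mem_diffs.mpr ⟨w, hw, p, hp, rfl⟩)))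
  have h3 : q ∩ w ∈ scTerms P Q W := by
    unfold scTerms; simp only [mem_union]
    exact Or.inl (Or.inr (mem_infs.mpr ⟨q, hq, w, hw, rfl⟩))
  have h4 : q ∪ w ∈ scTerms P Q W := by
    unfold scTerms; simp only [mem_union]
    exact Or.inr (mem_sups.mpr ⟨q, hq, w, hw, rfl⟩)
  have hc : ∀ {t}, t ∈ scTerms P Q W → U \ t ∈ clU U (scTerms P Q W) :=
    fun ht => mem_clU.mpr (Or.inr ⟨_, ht, rfl⟩)
  exact ⟨mem_clU.mpr (Or.inl h1), mem_clU.mpr (Or.inl h2), mem_clU.mpr (Or.inl h3), mem_clU.mpr (Or.inl h4),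
    hc h1, hc h2, hc h3, hc h4⟩

/-- **Blockers are counted by their designated cross differences** (hp-7 gen 72/80).  For complement-free representatives
`W ⊆ scReps U P Q` of blocks `P`, `Q` in `U`, with `D₅ = W ∩ (P \\ Q)` (type 5, `w = p \ q`) and `D₂ = {d ∈ Q \\ P | U \ d ∈ W}`
(type 2, `w = p ∪ (U \ q)`, `U \ w = q \ p`): `#W ≤ #(D₅ ∪ D₂)` (via `w ↦ w` or `w ↦ U \ w`). -/
theorem card_le_card_designated (P Q W : Finset (Finset α)) (hU : ∀ a ∈ P ∪ Q, a ⊆ U)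
    (hrep : W ⊆ scReps U P Q) (hWco : ∀ a ∈ W, ∀ b ∈ W, a ≠ U \ b) :
    #W ≤ #(((P \\ Q).filter fun d => d ∈ W) ∪ ((Q \\ P).filter fun d => U \ d ∈ W)) := by
  classical
  have hQ : ∀ {a}, a ∈ Q → a ∈ P ∪ Q := fun ha => mem_union_right _ ha
  have hcc : ∀ {a : Finset α}, a ⊆ U → U \ (U \ a) = a := fun ha => Finset.sdiff_sdiff_eq_self ha
  have hWU : ∀ w ∈ W, w ⊆ U := fun w hw => subset_of_mem_scReps hU (hrep hw)
  set D₅ : Finset (Finset α) := (P \\ Q).filter fun d => d ∈ W with hD₅def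
  set D₂ : Finset (Finset α) := (Q \\ P).filter fun d => U \ d ∈ W with hD₂def
  refine card_le_card_of_injOn (fun w => if w ∈ P \\ Q then w else U \ w) ?_ ?_
  · intro w hw
    have hw' := hrep (mem_coe.mp hw)
    simp only [mem_coe]
    by_cases hwd : w ∈ P \\ Q
    · rw [if_pos hwd]; exact mem_union_left _ (mem_filter.mpr ⟨hwd, mem_coe.mp hw⟩)
    · rw [if_neg hwd]
      unfold scReps at hw'
      rcases mem_union.mp hw' with h | h
      · exact absurd h hwd
      · obtain ⟨pq, hpq, hpqw⟩ := mem_image.mp h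
        obtain ⟨hp₀, hq₀⟩ := mem_product.mp hpq
        have hq₀U : pq.2 ⊆ U := hU _ (hQ hq₀)
        have he_eq : U \ w = pq.2 \ pq.1 := by
          rw [← hpqw]
          ext i; simp only [mem_sdiff, mem_union]
          constructor
          · rintro ⟨hiU, h⟩
            refine ⟨?_, fun h1 => h (Or.inl h1)⟩
            by_contra h2; exact h (Or.inr ⟨hiU, h2⟩)
          · rintro ⟨hi2, hi1⟩
            exact ⟨hq₀U hi2, fun h => h.elim hi1 (fun h' => h'.2 hi2)⟩
        refine mem_union_right _ (mem_filter.mpr ⟨?_, ?_⟩)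
        · rw [he_eq]; exact sdiff_mem_diffs hq₀ hp₀
        · rw [hcc (hWU w (mem_coe.mp hw))]; exact mem_coe.mp hw
  · intro w hw w' hw' hww
    simp only at hww
    have hwU := hWU w (mem_coe.mp hw); have hw'U := hWU w' (mem_coe.mp hw')
    by_cases h1 : w ∈ P \\ Q <;> by_cases h2 : w' ∈ P \\ Q
    · rwa [if_pos h1, if_pos h2] at hww
    · rw [if_pos h1, if_neg h2] at hww
      exact absurd hww (hWco w (mem_coe.mp hw) w' (mem_coe.mp hw'))
    · rw [if_neg h1, if_pos h2] at hww
      exact absurd hww.symm (hWco w' (mem_coe.mp hw') w (mem_coe.mp hw))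
    · rw [if_neg h1, if_neg h2] at hww
      rw [← hcc hwU, hww, hcc hw'U]

end ExtReserved

end Summit.CriticalPhenomena.PercolationContinuityZ3.Theorems
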